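import Literature.Probability.Percolation.QuadCrossingBottomClusterData
import Literature.Probability.Percolation.QuadCrossingExplorationExitSetStripAt
import Literature.Probability.Percolation.QuadCrossingExplorationBelowBarrier
import Literature.Probability.Percolation.QuadCrossingExplorationWalls
import Literature.Probability.Percolation.QuadCrossingSeparatorArmMid
import Literature.Probability.Percolation.QuadCrossingContinuityCaseTwoTame
import HarnessLib

/-!
# The fresh open arm of the dual exploration (Lemma 6.1, case (3))

Topic `Probability/Percolation`; chart-level proofs file towards the named fact
`SchrammSmirnov2011_lemma_6_1` (`QuadCrossingContinuity.lean`; O. Schramm, S. Smirnov, *On the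
scaling limits of planar percolation*, Ann. Probab. 39 (2011), arXiv:1101.5820, proof of Lemma 6.1,
p. 23: "the proof in case (3) is symmetric to that of case (2)").

In the dual picture of case (3) (`QuadCrossingRot.lean`) the pair `(Q, Q')` satisfies condition (2),
the small quad `Q'` has a DUAL crossing (a path of `[Q']` from `∂₀Q'` to `∂₂Q'` off the drawn open
edges `O`) and the big quad `Q` has an OPEN transversal crossing (a continuum of `[Q] ∩ O` meeting
`∂₁Q` and `∂₃Q`).  The datum is the bottom open cluster `d = C_b(ω)` of `[Q']`
(`QuadCrossingBottomCluster.lean`), its wall point is `x♭ = Q'(1, θ_C)` (`Quad.dualWallPt`), and the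
revealed edges are `revealedB d` (`QuadCrossingBottomClusterData.lean`).  This file proves the KEY
INCLUSION of the decoupling: if `x♭` is far from `∂₃Q`, the configuration has an open crossing of
the annulus `A(x♭; 2Kρ + 4δ', c₃/2 - 4Kρ - δ')` using no edge of `revealedB d`
(`Charts.mem_annulusOpenCrossingOff_of_dual`).

The proof is the mirror image of `QuadCrossingSeparatorArmOff.lean`: take a dual crossing `γ` of
`Q'` landing at `y = Q'(1, θ)` just above `θ_C` (`Quad.exists_dualPath_landing_lt`, cut at its
first visit to `∂₂Q'`; `θ_C ≤ θ` by `Quad.topContact_le_of_dualPath`), the strip exit set `E ∋ y` at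
`y` (`Charts.exists_exitSet_strip_at`, chord–arc hypothesis `harc`), the wall `W = γ ∪ E` and the
region `M` of `[Q]` below it; `d ⊆ M` (chains of open pieces from `∂₁Q'` stay below the barrier
`γ`: `Charts.image_subset_below_of_mem_belowSet`); the open transversal crossing, as a path `κ`,
starts in `M` and ends off `M`, so after its last time in `M` (a point of `E`, within `K ρ` of `y`)
it is an open path off `M` reaching distance `c₃/2 - 4Kρ` from `x♭` (`hfar`); its portion after
the last visit of `B̄(x♭, 2Kρ + 3δ')` uses no revealed edge: an open revealed edge has its piece in
`d ⊆ M`, and by lattice tameness of `[Q]` its segment leaves `M` only across `E`, within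
`2Kρ + 2δ'` of `x♭`.  Everything is proved; no named fact is introduced.

## References

* O. Schramm, S. Smirnov, Ann. Probab. 39 (2011) 1768–1814, arXiv:1101.5820, proof of Lemma 6.1,
  cases (2)–(3), eq. (6.2). [SchrammSmirnov2011]
-/

noncomputable section

open Set Metric Filter Function
open _root_.Topology
open scoped unitInterval
open Literature.Probability.LatticeModels
open Literature.Topology.PlaneTopology

namespace Literature.Probability.Percolation

namespace QuadCrossing

namespace Quad

variable {D : Set ℂ}

/-- **The wall point of the dual exploration**: `x♭ = Q(1, θ_C)`, the top contact of the bottom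
open cluster with the free side (the corner `Q(1, 0)` if there is no contact).
[cite: SchrammSmirnov2011, proof of Lemma 6.1, case (3)] -/
def dualWallPt (Q : Quad D) (δ : ℝ) (ω : BondConfig (Site 2)) : ℂ :=
  Q (1, ⟨Q.topContact δ ω, topContact_mem_Icc⟩)

/-- The wall point is on the free side. [folklore] -/
theorem dualWallPt_mem_side_two (Q : Quad D) (δ : ℝ) (ω : BondConfig (Site 2)) :
    Q.dualWallPt δ ω ∈ Q.side 2 := ⟨(1, _), rfl, rfl⟩

end Quad

end QuadCrossing

namespace SSContinuity

namespace Frame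

variable (Φ : Frame) {D : Set ℂ} {Q Q' : QuadCrossing.Quad D} {ω : BondConfig (Site 2)}

/-- A point of the bottom side of `R'` off the barrier `C ⊆ R'` is below `C`: drop to the bottom
margin along the vertical segment. [folklore] -/
theorem mem_belowSet_of_im_eq_c {C : Set ℂ} (hCr : C ⊆ Φ.rect) {u : ℂ} (hu : u ∈ Φ.rect)
    (huim : u.im = Φ.c) (huC : u ∉ C) : u ∈ Φ.belowSet C := by
  set k : ℂ := ⟨u.re, Φ.c - Φ.η⟩ with hk
  have hkbot : k ∈ Φ.bottom := ⟨hu.1, by simp [hk]⟩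
  refine Φ.mem_belowSet_of_joinedIn (Φ.mem_belowSet_of_mem_bottom hCr hkbot)
    (JoinedIn.ofLine (f := fun t : ℝ => AffineMap.lineMap k u t)
      AffineMap.lineMap_continuous.continuousOn (AffineMap.lineMap_apply_zero _ _)
      (AffineMap.lineMap_apply_one _ _) ?_)
  rw [← segment_eq_image_lineMap]
  intro w hw
  obtain ⟨τ, hτ, hre, him⟩ := exists_of_mem_segment hw
  have hkim : k.im = Φ.c - Φ.η := rfl
  have hkre : k.re = u.re := rfl
  rw [hkre] at hre
  rw [hkim, huim] at him
  have hwre : w.re = u.re := by rw [hre]; ring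
  have hwim : w.im = Φ.c - Φ.η + τ * Φ.η := by rw [him]; ring
  refine ⟨⟨show w.re ∈ Icc Φ.a Φ.b by rw [hwre]; exact hu.1,
    show w.im ∈ Icc (Φ.c - Φ.η) Φ.d from ⟨by rw [hwim]; nlinarith [hτ.1, Φ.hη],
      by rw [hwim]; nlinarith [hτ.2, Φ.hη, Φ.hcd]⟩⟩, fun hwC => ?_⟩
  have hwc : Φ.c ≤ w.im := (hCr hwC).2.1
  have hτ1 : τ = 1 := by
    by_contra hne
    have : τ < 1 := lt_of_le_of_ne hτ.2 hne
    have : w.im < Φ.c := by rw [hwim]; nlinarith [Φ.hη]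
    linarith
  have hwu : w = u := Complex.ext hwre (by rw [hwim, hτ1, huim]; ring)
  exact huC (hwu ▸ hwC)

variable {Φ} in
/-- **The fresh open arm of the dual exploration** (see the module docstring).  The frame is the
standard one (`hb`, `hc`, `hd`, `hG`) of the small quad `Q'`; `(Q, Q')` satisfies condition (2) at
scale `ρ < d₀(Q)`; both quads are lattice-tame at the mesh `δ' = Φ.δ`; `∂₂Q'` is `K`-chord–arc at
scale `ρ`; the wall point `x♭` is far from `∂₃Q`; `Q'` has a dual crossing off the open edges and `Q`
an open transversal crossing.  Then
`ω ∈ annulusOpenCrossingOff (revealedB d) x♭ δ' (2Kρ + 4δ') (c₃/2 - 4Kρ - δ')`, `d = C_b(ω)`.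
[cite: SchrammSmirnov2011, proof of Lemma 6.1, case (3) via case (2), eq. (6.2)] -/
theorem Charts.mem_annulusOpenCrossingOff_of_dual (hΦ : Φ.Charts Q') (hb : Φ.b = 1)
    (hc : Φ.c = -1) (hd : Φ.d = 1) (hG : ∀ t : I, Φ.G ⟨1, 2 * (t : ℝ) - 1⟩ = Q' (1, t))
    (hcar : Q'.carrier ⊆ Q.carrier) (h0 : Q'.side 0 = Q.side 0) (h1 : Q'.side 1 ⊆ Q.side 1)
    (h3 : Q'.side 3 ⊆ Q.side 3) {ρ : ℝ} (hρ : 0 < ρ) (hρ0 : ρ < Q.sideDist 0)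
    (hjoin : ∀ x ∈ Q'.side 2, Q.ShortJoin ρ x (Q.side 2))
    (htame : ∀ a b : Site 2, (zdGraph 2).Adj a b →
      IsPreconnected (segment ℝ (meshPoint Φ.δ a) (meshPoint Φ.δ b) ∩ Q.carrier))
    (htame' : ∀ p : Site 2 × Site 2, (zdGraph 2).Adj p.1 p.2 →
      IsPreconnected (Q'.piece Φ.δ p))
    {K : ℝ} (hK : 1 ≤ K)
    (harc : ∀ s t : I, dist (Q' (1, s)) (Q' (1, t)) ≤ ρ → ∀ u : I,
      ((s : ℝ) ≤ u ∧ (u : ℝ) ≤ t ∨ (t : ℝ) ≤ u ∧ (u : ℝ) ≤ s) → dist (Q' (1, u)) (Q' (1, s)) ≤ K * ρ)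
    {c₃ : ℝ} (hc₃ : 12 * (K * ρ) + 6 * Φ.δ < c₃)
    (hfar : ∀ t ∈ Q.side 3, ∀ p : Path (Q'.dualWallPt Φ.δ ω) t, range p ⊆ Q.carrier →
      c₃ ≤ Metric.diam (range p))
    (hdual : ∃ β : ℝ → ℂ, ContinuousOn β (Icc 0 1) ∧ MapsTo β (Icc 0 1) Q'.carrier ∧ β 0 ∈ Q'.side 0 ∧
      β 1 ∈ Q'.side 2 ∧ ∀ t ∈ Icc (0 : ℝ) 1, β t ∉ openEdgeUnion Φ.δ ω)
    (hKop : ∃ Kset : Set ℂ, IsCompact Kset ∧ IsConnected Kset ∧ Kset ⊆ Q.carrier ∧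
      Kset ⊆ openEdgeUnion Φ.δ ω ∧ (Kset ∩ Q.side 1).Nonempty ∧ (Kset ∩ Q.side 3).Nonempty) :
    ω ∈ annulusOpenCrossingOff (Q'.revealedB Φ.δ (Q'.bottomCluster Φ.δ ω)) (Q'.dualWallPt Φ.δ ω)
      Φ.δ (2 * (K * ρ) + 4 * Φ.δ) (c₃ / 2 - 4 * (K * ρ) - Φ.δ) := by
  have hδ : 0 < Φ.δ := Φ.hδ
  have hKρ : ρ ≤ K * ρ := by nlinarith
  have hKρ0 : 0 ≤ K * ρ := by positivity
  set d : Set ℂ := Q'.bottomCluster Φ.δ ω with hd_def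
  set S : Set (Sym2 (Site 2)) := Q'.revealedB Φ.δ d with hS_def
  set θC : ℝ := Q'.topContact Φ.δ ω with hθC
  have hθCI : θC ∈ Icc (0 : ℝ) 1 := QuadCrossing.Quad.topContact_mem_Icc
  set tC : I := ⟨θC, hθCI⟩ with htC
  set xb : ℂ := Q'.dualWallPt Φ.δ ω with hxb
  have hxbeq : xb = Q' (1, tC) := rfl
  -- Step 1: a dual crossing landing close to the wall point
  obtain ⟨η, hη, hηcont⟩ : ∃ η > 0, ∀ θ : I, dist θ tC < η → dist (Q' (1, θ)) xb < ρ := by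
    have hcont : Continuous fun θ : I => Q' (1, θ) :=
      Q'.continuous_toFun.comp (continuous_const.prodMk continuous_id)
    obtain ⟨η, hη, h⟩ := (Metric.continuousAt_iff.1 (hcont.continuousAt (x := tC))) ρ hρ
    exact ⟨η, hη, fun θ hθ => by rw [hxbeq]; exact h hθ⟩
  obtain ⟨β, hβc, hβQ, hβ0, hβ1, hβO, hβside⟩ :=
    QuadCrossing.Quad.exists_dualPath_landing_lt hδ htame' hdual hη
  -- Step 2: cut at the first visit of `∂₂Q'`
  set T : Set ℝ := {t | t ∈ Icc (0 : ℝ) 1 ∧ β t ∈ Q'.side 2} with hT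
  have hTc : IsClosed T := hβc.preimage_isClosed_of_isClosed isClosed_Icc (Q'.isCompact_side 2).isClosed
  have hT1 : (1 : ℝ) ∈ T := ⟨right_mem_Icc.2 zero_le_one, hβ1⟩
  have hTbdd : BddBelow T := ⟨0, fun t ht => ht.1.1⟩
  set tS : ℝ := sInf T with htS
  have htST : tS ∈ T := hTc.csInf_mem ⟨1, hT1⟩ hTbdd
  have htSI : tS ∈ Icc (0 : ℝ) 1 := htST.1
  have htS2 : β tS ∈ Q'.side 2 := htST.2
  have hbefore : ∀ t ∈ Icc (0 : ℝ) 1, t < tS → β t ∉ Q'.side 2 := fun t ht hlt h2 =>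
    absurd (csInf_le hTbdd ⟨ht, h2⟩) (not_le.2 hlt)
  have htS0 : 0 < tS := by
    rcases htSI.1.eq_or_lt with h | h
    · exfalso
      rw [← h] at htS2
      exact Set.disjoint_left.1 (Q'.disjoint_side_side_add_two 0) hβ0 htS2
    · exact h
  obtain ⟨hγc, hγ0, hγ1, hγmaps⟩ := QuadCrossing.exists_reparam hβc le_rfl htS0.le htSI.2
  set γ : ℝ → ℂ := fun t => β (0 + t * (tS - 0)) with hγ
  have hγI : ∀ t ∈ Icc (0 : ℝ) 1, 0 + t * (tS - 0) ∈ Icc (0 : ℝ) 1 := fun t ht =>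
    let h := hγmaps t ht; ⟨h.1, h.2.trans htSI.2⟩
  have hγQ : MapsTo γ (Icc 0 1) Q'.carrier := fun t ht => hβQ (hγI t ht)
  have hγO : ∀ t ∈ Icc (0 : ℝ) 1, γ t ∉ openEdgeUnion Φ.δ ω := fun t ht => hβO _ (hγI t ht)
  have hγ0side : γ 0 ∈ Q'.side 0 := by rw [hγ0]; exact hβ0
  have hγ12 : γ 1 ∈ Q'.side 2 := by rw [hγ1]; exact htS2
  have hfirst : ∀ t ∈ Ico (0 : ℝ) 1, γ t ∉ Q'.side 2 := fun t ht => by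
    refine hbefore _ (hγI t ⟨ht.1, ht.2.le⟩) ?_
    have : 0 + t * (tS - 0) = t * tS := by ring
    rw [this]
    nlinarith [ht.2, htS0]
  -- the landing point `y = Q'(1, θn)` with `θ_C ≤ θn < θ_C + η`
  set y : ℂ := γ 1 with hy
  obtain ⟨θn, hθn⟩ : ∃ θ : I, y = Q' (1, θ) := by
    obtain ⟨⟨s₀, θ⟩, hs, hsy⟩ := (show y ∈ Q' '' {z : I × I | z.1 = 1} from hγ12)
    simp only [mem_setOf_eq] at hs
    subst hs
    exact ⟨θ, hsy.symm⟩
  have hθCn : θC ≤ (θn : ℝ) :=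
    QuadCrossing.Quad.topContact_le_of_dualPath hδ htame' hγc hγQ hγ0side hγO hθn hfirst
  have hθnη : (θn : ℝ) < θC + η := hβside tS htSI θn (by rw [← hθn]; exact hγ1.symm)
  have hyx : dist y xb < ρ := by
    rw [hθn]
    refine hηcont θn ?_
    rw [Subtype.dist_eq, Real.dist_eq, abs_of_nonneg (by simp only [htC]; linarith)]
    simp only [htC]; linarith
  -- Step 3: chart data of the barrier `Γ = G⁻¹(γ)`
  set h : ℝ := 2 * (θn : ℝ) - 1 with hh
  have hhI : h ∈ Icc Φ.c Φ.d := by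
    rw [hc, hd, hh]; constructor <;> linarith [θn.2.1, θn.2.2]
  set yh : ℂ := ⟨Φ.b, h⟩ with hyh
  have hGy : Φ.G yh = y := by
    rw [hθn, ← hG θn, hyh]
    congr 1
    apply Complex.ext <;> simp [hb, hh]
  have hpreim : ∀ {w : ℂ}, w ∈ Q'.carrier → Φ.G.symm w ∈ Φ.rect := by
    intro w hw
    rw [hΦ.carrier] at hw
    obtain ⟨u, hu, rfl⟩ := hw
    rwa [Φ.G.symm_apply_apply]
  set Γ : Set ℂ := Φ.G.symm '' (γ '' Icc 0 1) with hΓ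
  have hGΓ : Φ.G '' Γ = γ '' Icc 0 1 := by
    rw [hΓ, ← image_comp]
    simp only [Function.comp_def, Homeomorph.apply_symm_apply, image_id']
  have hγimc : IsCompact (γ '' Icc 0 1) := isCompact_Icc.image_of_continuousOn hγc
  have hΓc : IsCompact Γ := hγimc.image Φ.G.symm.continuous
  have hΓpc : IsPreconnected Γ :=
    (isPreconnected_Icc.image _ hγc).image _ Φ.G.symm.continuous.continuousOn
  have hΓr : Γ ⊆ Φ.rect := by
    rintro _ ⟨z, ⟨t, ht, rfl⟩, rfl⟩
    exact hpreim (hγQ ht)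
  have hΓa : ∃ z ∈ Γ, z.re = Φ.a := by
    have h0' := hγ0side
    rw [hΦ.side0] at h0'
    obtain ⟨u, ⟨hur, hure⟩, hue⟩ := h0'
    refine ⟨u, ⟨γ 0, ⟨0, left_mem_Icc.2 zero_le_one, rfl⟩, ?_⟩, hure⟩
    rw [← hue, Φ.G.symm_apply_apply]
  have hyhΓ : yh ∈ Γ := ⟨y, ⟨1, right_mem_Icc.2 zero_le_one, rfl⟩, by
    rw [← hGy, Φ.G.symm_apply_apply]⟩
  have hΓb : ∃ z ∈ Γ, z.re = Φ.b := ⟨yh, hyhΓ, rfl⟩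
  have hΓtop : ∀ z ∈ Γ, z.re = Φ.b → z.im ≤ h := by
    rintro z ⟨_, ⟨t, ht, rfl⟩, rfl⟩ hzre
    have hzrect : Φ.G.symm (γ t) ∈ Φ.rect := hpreim (hγQ ht)
    have h2 : γ t ∈ Q'.side 2 := by
      rw [hΦ.side2]
      exact ⟨Φ.G.symm (γ t), ⟨hzrect, hzre⟩, Φ.G.apply_symm_apply _⟩
    have ht1 : t = 1 := by
      by_contra hne
      exact hfirst t ⟨ht.1, lt_of_le_of_ne ht.2 hne⟩ h2
    subst ht1
    have : Φ.G.symm (γ 1) = yh := by rw [← hy, ← hGy, Φ.G.symm_apply_apply]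
    rw [this]
  have hΓO : ∀ z ∈ Γ, Φ.G z ∉ openEdgeUnion Φ.δ ω := by
    rintro _ ⟨_, ⟨t, ht, rfl⟩, rfl⟩
    rw [Φ.G.apply_symm_apply]; exact hγO t ht
  -- Step 4: the exit set at `y`
  have hy2' : y ∈ Q'.side 2 := hγ12
  obtain ⟨y₂, hy₂, α, hαQ, hαdiam⟩ := hjoin y hy2'
  have hαx : ∀ s, dist (α s) y ≤ ρ := fun s =>
    (dist_le_diam_of_mem (isCompact_range α.continuous).isBounded ⟨s, rfl⟩ ⟨0, α.source⟩).trans hαdiam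
  have hα0 : ∀ s, α s ∉ Q'.side 0 := fun s hs => by
    rw [h0] at hs
    have := QuadCrossing.Quad.sideDist_le hs hy₂ (QuadCrossing.Quad.tailPath α s)
      ((QuadCrossing.Quad.range_tailPath α s).trans hαQ)
    have hle : Metric.diam (range (QuadCrossing.Quad.tailPath α s)) ≤ ρ :=
      (diam_mono (QuadCrossing.Quad.range_tailPath α s) (isCompact_range α.continuous).isBounded).trans
        hαdiam
    linarith
  set α' : Path (Φ.G yh) y₂ := α.cast hGy rfl with hα'
  have hα'coe : ∀ s, α' s = α s := fun s => by rw [hα', Path.cast_coe]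
  obtain ⟨E, m, M, hEc, hEpc, hEQ, hxE, hE2, hEjoin, hAE, hEm, hE0, -, -, -, -, -, -⟩ :=
    hΦ.exists_exitSet_strip_at hb hc hd hG hhI hρ.le hK harc hcar h0 h1 h3 hy₂ α'
      (by rintro _ ⟨s, rfl⟩; rw [hα'coe]; exact hαQ ⟨s, rfl⟩)
      (fun s => by rw [hα'coe, hGy]; exact hαx s) (fun s => by rw [hα'coe]; exact hα0 s)
  rw [hGy] at hxE hEjoin
  have hEy : ∀ e ∈ E, dist e y ≤ K * ρ := fun e he => by
    obtain ⟨p, -, hp⟩ := hEjoin e he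
    simpa [p.target] using hp 1
  have hEx : ∀ e ∈ E, dist e xb ≤ 2 * (K * ρ) := fun e he => by
    linarith [dist_triangle e y xb, hEy e he, hyx.le]
  -- Step 5: the wall and the region below it
  set W : Set ℂ := Φ.G '' Γ ∪ E with hW
  set Mreg : Set ℂ := {z | z ∈ Q.carrier ∧ ∀ t ∈ Q.side 3, ∀ π : Path z t,
      range π ⊆ Q.carrier → (range π ∩ W).Nonempty} with hMreg
  have hLc : IsCompact (Φ.G '' Γ) := by rw [hGΓ]; exact hγimc
  have hWc : IsCompact W := hLc.union hEc
  have hWcl : IsClosed W := hWc.isClosed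
  have hyL : y ∈ Φ.G '' Γ := by rw [hGΓ]; exact ⟨1, right_mem_Icc.2 zero_le_one, rfl⟩
  have hWpc : IsPreconnected W := by
    rw [hW]
    refine IsPreconnected.union y hyL hxE ?_ hEpc
    rw [hGΓ]; exact isPreconnected_Icc.image _ hγc
  have hWQ : W ⊆ Q.carrier := by
    refine union_subset ?_ hEQ
    rw [hGΓ]; rintro _ ⟨t, ht, rfl⟩; exact hcar (hγQ ht)
  have hW0 : (W ∩ Q.side 0).Nonempty :=
    ⟨γ 0, Or.inl (by rw [hGΓ]; exact ⟨0, left_mem_Icc.2 zero_le_one, rfl⟩), h0 ▸ hγ0side⟩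
  have hW2 : (W ∩ Q.side 2).Nonempty := hE2.mono (inter_subset_inter_left _ subset_union_right)
  have hside1M := QuadCrossing.Quad.side_one_subset_below hWc hWpc hWQ hW0 hW2
  have hWO : ∀ z ∈ W, z ∈ openEdgeUnion Φ.δ ω → z ∈ E := by
    rintro z (⟨u, hu, rfl⟩ | hzE) hzO
    · exact absurd hzO (hΓO u hu)
    · exact hzE
  -- Step 6: the bottom cluster is below the wall
  have hdM : d ⊆ Mreg := by
    intro p hp
    obtain ⟨q₀, hq₀, hpq₀⟩ := mem_iUnion₂.1 hp
    obtain ⟨U, hUd, hUpc, ⟨bpt, hbU, hb1⟩, hq₀U⟩ :=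
      QuadCrossing.Quad.exists_isPreconnected_of_reach htame' hq₀
    have hUO : U ⊆ openEdgeUnion Φ.δ ω := fun z hz => (QuadCrossing.Quad.bottomCluster_subset (hUd hz)).1
    have hUQ' : U ⊆ Q'.carrier := fun z hz => (QuadCrossing.Quad.bottomCluster_subset (hUd hz)).2
    have hKc : IsCompact (closure U) :=
      Q'.isCompact_carrier.of_isClosed_subset isClosed_closure
        (Q'.isCompact_carrier.isClosed.closure_subset_iff.2 hUQ')
    have hKconn : IsConnected (closure U) := ⟨⟨bpt, subset_closure hbU⟩, hUpc.closure⟩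
    have hKO : closure U ⊆ openEdgeUnion Φ.δ ω :=
      (isClosed_openEdgeUnion hδ ω).closure_subset_iff.2 hUO
    have hKQ' : closure U ⊆ Q'.carrier := Q'.isCompact_carrier.isClosed.closure_subset_iff.2 hUQ'
    have hJ := joinedIn_inter_openEdgeUnion_of_isConnected hδ hKc hKconn hKO hKQ'
      (subset_closure hbU) (subset_closure (hq₀U hpq₀))
    set π₀ : Path bpt p := hJ.somePath with hπ₀
    have hπ₀mem : ∀ t, π₀ t ∈ Q'.carrier ∩ openEdgeUnion Φ.δ ω := hJ.somePath_mem
    -- in the chart: the base point is on the bottom side, off `Γ`, hence below `Γ`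
    set bh : ℂ := Φ.G.symm bpt with hbh
    have hbhrect : bh ∈ Φ.rect := hpreim (hπ₀mem 0 |>.1 |> fun h => by simpa [π₀.source] using h)
    have hb1' := hb1
    rw [hΦ.side1] at hb1'
    obtain ⟨u, ⟨hur, huim⟩, hue⟩ := hb1'
    have hbhu : bh = u := by rw [hbh, ← hue, Φ.G.symm_apply_apply]
    have hbhΓ : bh ∉ Γ := fun hmem => hΓO bh hmem (by
      rw [hbh, Φ.G.apply_symm_apply]; exact hUO hbU)
    have hbhbelow : bh ∈ Φ.belowSet Γ :=
      Φ.mem_belowSet_of_im_eq_c hΓr hbhrect (by rw [hbhu]; exact huim) hbhΓ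
    -- the chart image of the open chain joins `bh` to `G⁻¹ p` off `Γ`
    set ph : ℂ := Φ.G.symm p with hph
    have hJ' : JoinedIn (Φ.extRect \ Γ) bh ph := by
      refine ⟨(π₀.map Φ.G.symm.continuous).cast (by rw [hbh]) (by rw [hph]), fun t => ?_⟩
      rw [Path.cast_coe, Path.map_coe, Function.comp_apply]
      refine ⟨Φ.rect_subset_extRect (hpreim (hπ₀mem t).1), fun hmem => ?_⟩
      exact hΓO _ hmem (by rw [Φ.G.apply_symm_apply]; exact (hπ₀mem t).2)
    have hphbelow : ph ∈ Φ.belowSet Γ := Φ.mem_belowSet_of_joinedIn hbhbelow hJ'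
    have hphrect : ph ∈ Φ.rect := hpreim (hUQ' (hq₀U hpq₀))
    have := hΦ.image_subset_below_of_mem_belowSet hcar h0 h1 hΓc hΓpc hΓr hΓa hΓb hΓtop hEc hEQ
      hWpc hE2 hAE hEm hE0 hphbelow hphrect
    rwa [hph, Φ.G.apply_symm_apply] at this
  -- Step 7: the open transversal crossing as a path; its last time below the wall
  obtain ⟨Kset, hKsc, hKsconn, hKsQ, hKsO, ⟨a₁, ha₁K, ha₁⟩, ⟨a₃, ha₃K, ha₃⟩⟩ := hKop
  have hJκ := joinedIn_inter_openEdgeUnion_of_isConnected hδ hKsc hKsconn hKsO hKsQ ha₁K ha₃K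
  set κ : Path a₁ a₃ := hJκ.somePath with hκ
  have hκmem : ∀ t, κ t ∈ Q.carrier ∩ openEdgeUnion Φ.δ ω := hJκ.somePath_mem
  set f : ℝ → ℂ := fun s => κ.extend s with hf
  have hfc : ContinuousOn f (Icc 0 1) := κ.continuous_extend.continuousOn
  have hfmem : ∀ s, f s ∈ Q.carrier ∩ openEdgeUnion Φ.δ ω := fun s => hκmem _
  have hfQ : MapsTo f (Icc 0 1) Q.carrier := fun s _ => (hfmem s).1
  have hf0 : f 0 = a₁ := κ.extend_zero
  have hf1 : f 1 = a₃ := κ.extend_one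
  have hf0M : f 0 ∈ Mreg := by rw [hf0]; exact hside1M ha₁
  -- side arc from the wall point to the landing point, within `K ρ` of `x♭`
  have harcx : ∀ u : I, (θC ≤ (u : ℝ) ∧ (u : ℝ) ≤ θn) → dist (Q' (1, u)) xb ≤ K * ρ := fun u hu => by
    rw [hxbeq]
    refine harc tC θn ?_ u (Or.inl ⟨hu.1, hu.2⟩)
    rw [← hxbeq, ← hθn, dist_comm]; exact hyx.le
  -- paths from `x♭` through `y` and a point of `E` have small beginnings: the `∂₃Q` endpoint is off `W`
  have hpath_small : ∀ e ∈ E, ∃ p : Path xb e, range p ⊆ Q.carrier ∧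
      ∀ s, dist (p s) xb ≤ 2 * (K * ρ) := by
    intro e he
    obtain ⟨j, hjQ, hj⟩ := hEjoin e he
    set arc : Path xb y := (sideArc Q' tC θn).cast hxbeq hθn with harc'
    refine ⟨arc.trans j, ?_, fun s => ?_⟩
    · rw [Path.trans_range]
      refine union_subset ?_ hjQ
      rintro _ ⟨s, rfl⟩
      rw [harc', Path.cast_coe]
      obtain ⟨θ', hθ', -⟩ := range_sideArc_subset Q' tC θn ⟨s, rfl⟩
      rw [hθ']; exact hcar (Q'.side_subset_carrier 2 ⟨(1, θ'), rfl, rfl⟩)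
    · have : (arc.trans j) s ∈ range arc ∪ range j := by
        rw [← Path.trans_range]; exact ⟨s, rfl⟩
      rcases this with ⟨s', hs'⟩ | ⟨s', hs'⟩
      · rw [← hs', harc', Path.cast_coe]
        obtain ⟨θ', hθ', hbet⟩ := range_sideArc_subset Q' tC θn ⟨s', rfl⟩
        rw [hθ']
        have hb' : θC ≤ (θ' : ℝ) ∧ (θ' : ℝ) ≤ θn := by
          rcases hbet with hb' | hb'
          · exact ⟨hb'.1, hb'.2⟩
          · exact ⟨hθCn.trans hb'.1, by
              have : (θ' : ℝ) ≤ θC := hb'.2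
              linarith⟩
        linarith [harcx θ' hb']
      · rw [← hs']
        linarith [dist_triangle (j s') y xb, hj s', hyx.le]
  have ha₃W : a₃ ∉ W := by
    intro ha₃W
    have ha₃E : a₃ ∈ E := hWO a₃ ha₃W (hκmem 1 |>.2 |> fun h => by simpa [κ.target] using h)
    obtain ⟨p, hpQ, hp⟩ := hpath_small a₃ ha₃E
    have hdiam : Metric.diam (range p) ≤ 4 * (K * ρ) := by
      refine Metric.diam_le_of_forall_dist_le (by positivity) ?_
      rintro _ ⟨s, rfl⟩ _ ⟨s', rfl⟩
      linarith [dist_triangle (p s) xb (p s'), dist_comm xb (p s'), hp s, hp s']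
    have := hfar a₃ ha₃ p hpQ
    linarith
  have hf1M : f 1 ∉ Mreg := by
    rw [hf1]
    exact QuadCrossing.Quad.not_mem_below_of_path_avoiding ha₃ (Path.refl a₃)
      (by rintro _ ⟨s, rfl⟩; exact Q.side_subset_carrier 3 ha₃) (fun s => by simpa using ha₃W)
  obtain ⟨tσ, hσI, hσW, hafter⟩ :=
    QuadCrossing.Quad.exists_final_segment_avoiding_below hWcl hfc hfQ hf0M hf1M
  set e : ℂ := f tσ with he
  have heE : e ∈ E := hWO e hσW (hfmem tσ).2
  have hex : dist e xb ≤ 2 * (K * ρ) := hEx e heE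
  -- Step 8: the tail `g` of `κ` after `tσ`: off `M`, inside `O`, with a far point
  obtain ⟨hgc, hg0, hg1, hgmaps⟩ := QuadCrossing.exists_reparam hfc hσI.1 hσI.2.le le_rfl
  set g : ℝ → ℂ := fun t => f (tσ + t * (1 - tσ)) with hg
  have hgO : ∀ t, g t ∈ openEdgeUnion Φ.δ ω := fun t => (hfmem _).2
  have hgQ : ∀ t, g t ∈ Q.carrier := fun t => (hfmem _).1
  have hgout : ∀ t ∈ Ioc (0 : ℝ) 1, g t ∉ Mreg := fun t ht => by
    refine hafter (tσ + t * (1 - tσ)) ⟨?_, ?_⟩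
    · nlinarith [ht.1, hσI.2]
    · nlinarith [ht.2, hσI.1, hσI.2]
  have hg0x : dist (g 0) xb ≤ 2 * (K * ρ) := by rw [hg0]; exact hex
  -- the far point
  set R₀ : ℝ := c₃ / 2 - 4 * (K * ρ) with hR₀
  have hfarpt : ∃ t ∈ Icc (0 : ℝ) 1, R₀ ≤ dist (g t) xb := by
    obtain ⟨pg, hpg⟩ := QuadCrossing.exists_path_of_continuousOn hgc
    have hpgr : range pg ⊆ g '' Icc 0 1 := by
      rintro _ ⟨t, rfl⟩; exact ⟨t, t.2, (hpg t).symm⟩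
    obtain ⟨j, hjQ, hj⟩ := hpath_small e heE
    have he0 : e = g 0 := hg0.symm
    have ha₃1 : a₃ = g 1 := by rw [hg1, hf1]
    let big : Path xb a₃ := j.trans (pg.cast he0 ha₃1)
    have hbig_range : range big = range j ∪ range pg := by
      simp only [big, Path.trans_range, Path.cast_coe]
    have hbigQ : range big ⊆ Q.carrier := by
      rw [hbig_range]
      refine union_subset hjQ (hpgr.trans ?_)
      rintro _ ⟨t, -, rfl⟩; exact hgQ t
    have hd₁ : c₃ ≤ Metric.diam (range big) := hfar a₃ ha₃ big hbigQ
    have hdj : Metric.diam (range j) ≤ 4 * (K * ρ) := by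
      refine Metric.diam_le_of_forall_dist_le (by positivity) ?_
      rintro _ ⟨s, rfl⟩ _ ⟨s', rfl⟩
      linarith [dist_triangle (j s) xb (j s'), dist_comm xb (j s'), hj s, hj s']
    have hepg : e ∈ range j ∩ range pg := ⟨⟨1, j.target⟩, ⟨0, by rw [hpg]; exact hg0⟩⟩
    have hunion : Metric.diam (range big) ≤ 4 * (K * ρ) + Metric.diam (range pg) := by
      rw [hbig_range]
      have := Metric.diam_union' ⟨e, hepg⟩; linarith
    have hpgd : c₃ - 4 * (K * ρ) ≤ Metric.diam (range pg) := by linarith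
    by_contra hcon
    push Not at hcon
    have hKpg : IsCompact (range pg) := isCompact_range pg.continuous
    obtain ⟨m₀, hm₀, hmax⟩ := hKpg.exists_isMaxOn ⟨e, hepg.2⟩
      (continuous_id.dist continuous_const).continuousOn (f := fun z => dist z e)
    have hm₀lt : dist m₀ e < c₃ / 2 - 2 * (K * ρ) := by
      obtain ⟨t, ht, hteq⟩ := hpgr hm₀
      rw [← hteq]
      have h1 := hcon t ht
      linarith [dist_triangle (g t) xb e, dist_comm xb e, hex]
    have hbound : Metric.diam (range pg) ≤ 2 * dist m₀ e := by
      refine Metric.diam_le_of_forall_dist_le (by positivity) fun u hu v hv => ?_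
      have hu' : dist u e ≤ dist m₀ e := hmax hu
      have hv' : dist v e ≤ dist m₀ e := hmax hv
      linarith [dist_triangle u e v, dist_comm e v]
    linarith
  obtain ⟨t₁, ht₁, ht₁far⟩ := hfarpt
  -- Step 9: the arm: after the last visit of `B̄(x♭, r₁)`, until distance `R₀`
  set r₁ : ℝ := 2 * (K * ρ) + 3 * Φ.δ with hr₁
  have hr₁R : r₁ < R₀ := by rw [hr₁, hR₀]; linarith
  obtain ⟨hγ'c, hγ'0, hγ'1, hγ'maps⟩ := QuadCrossing.exists_reparam hgc le_rfl ht₁.1 ht₁.2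
  set γ' : ℝ → ℂ := fun t => g (0 + t * (t₁ - 0)) with hγ'
  have h0lt : dist (γ' 0) xb < r₁ := by rw [hγ'0]; linarith [hδ]
  have h1gt : r₁ < dist (γ' 1) xb := by rw [hγ'1]; linarith
  obtain ⟨u₀, hu₀, hu₀eq, hu₀after⟩ := QuadCrossing.exists_last_le
    (g := fun t => dist (γ' t) xb) ((continuous_id.dist continuous_const).comp_continuousOn hγ'c) h0lt h1gt
  obtain ⟨hγ₂c, hγ₂0, hγ₂1, hγ₂maps⟩ := QuadCrossing.exists_reparam hγ'c hu₀.1.le hu₀.2.le le_rfl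
  set γ₂ : ℝ → ℂ := fun t => γ' (u₀ + t * (1 - u₀)) with hγ₂
  have h0 : dist (γ₂ 0) xb < R₀ := by rw [hγ₂0, hu₀eq]; exact hr₁R
  have h1 : R₀ ≤ dist (γ₂ 1) xb := by rw [hγ₂1, hγ'1]; exact ht₁far
  obtain ⟨γ₃, hγ₃c, hγ₃0, hγ₃mem, hγ₃R, hγ₃1⟩ := QuadCrossing.exists_restrict_until_dist_ge hγ₂c h0 h1
  have hγ₃pts : ∀ t ∈ Icc (0 : ℝ) 1, ∃ v ∈ Icc (0 : ℝ) 1, γ₃ t = g v ∧ r₁ ≤ dist (g v) xb := by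
    intro t ht
    obtain ⟨u, hu, hu'⟩ := hγ₃mem t ht
    obtain ⟨hw1, hw2⟩ := hγ₂maps u hu
    set w : ℝ := u₀ + u * (1 - u₀) with hw
    have hwI : w ∈ Icc (0 : ℝ) 1 := ⟨hu₀.1.le.trans hw1, hw2⟩
    obtain ⟨hv1, hv2⟩ := hγ'maps w hwI
    refine ⟨0 + w * (t₁ - 0), ⟨hv1, hv2.trans ht₁.2⟩, by rw [← hu'], ?_⟩
    show r₁ ≤ dist (γ' w) xb
    rcases hw1.eq_or_lt with h' | h'
    · rw [← h', hu₀eq]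
    · exact (hu₀after w hwI h').le
  -- Step 10: freshness — arm points are off `M` and on no revealed edge
  have hgv_out : ∀ v ∈ Icc (0 : ℝ) 1, r₁ ≤ dist (g v) xb → g v ∉ Mreg := by
    intro v hv hfarv
    rcases hv.1.eq_or_lt with h' | h'
    · exfalso; rw [← h'] at hfarv; linarith [hδ]
    · exact hgout v ⟨h', hv.2⟩
  have hfresh : ∀ v ∈ Icc (0 : ℝ) 1, r₁ ≤ dist (g v) xb →
      g v ∈ openEdgeUnion Φ.δ (ω \ S) := by
    intro v hv hfarv
    have hzM : g v ∉ Mreg := hgv_out v hv hfarv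
    obtain ⟨a, b', hab, hωab, hseg⟩ := mem_openEdgeUnion_iff.1 (hgO v)
    refine mem_openEdgeUnion_iff.2 ⟨a, b', hab, ⟨hωab, fun hSab => ?_⟩, hseg⟩
    -- a revealed open edge: its piece lies in `d ⊆ M`, and is nonempty
    have hpiece : Q'.piece Φ.δ (a, b') ⊆ d :=
      QuadCrossing.Quad.piece_subset_of_mem_revealedB_of_mem rfl hab hSab hωab
    obtain ⟨w, hw⟩ : (Q'.piece Φ.δ (a, b')).Nonempty := by
      obtain ⟨a'', b'', -, heq, w, hw, -⟩ := hSab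
      have : Q'.piece Φ.δ (a'', b'') = Q'.piece Φ.δ (a, b') := by
        rcases Sym2.eq_iff.1 heq.symm with ⟨h₁, h₂⟩ | ⟨h₁, h₂⟩
        · rw [h₁, h₂]
        · rw [h₁, h₂]; exact QuadCrossing.Quad.piece_swap (a, b')
      exact ⟨w, this ▸ hw⟩
    have hwM : w ∈ Mreg := hdM (hpiece hw)
    -- the sub-segment from `w` to `g v` lies in `[Q]` (tameness of the big quad)
    have hwQ : w ∈ Q.carrier := hcar hw.2
    have hsub : segment ℝ w (g v) ⊆ segment ℝ (meshPoint Φ.δ a) (meshPoint Φ.δ b') ∩ Q.carrier :=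
      segment_subset_of_isPreconnected_subset_segment (htame a b' hab) inter_subset_left
        ⟨hw.1, hwQ⟩ ⟨hseg, hgQ v⟩
    -- it meets `W`, necessarily in `E`, within `2Kρ` of `x♭`; but its points are within `2δ'` of `g v`
    by_cases hmeet : ∃ s, (segPath (g v) w) s ∈ W
    · obtain ⟨s, hs⟩ := hmeet
      have hsseg : (segPath (g v) w) s ∈ segment ℝ w (g v) := by
        rw [segment_symm, ← range_segPath (g v) w]; exact ⟨s, rfl⟩
      obtain ⟨hsedge, -⟩ := hsub hsseg
      have hsO : (segPath (g v) w) s ∈ openEdgeUnion Φ.δ ω :=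
        mem_openEdgeUnion_iff.2 ⟨a, b', hab, hωab, hsedge⟩
      have hsE : (segPath (g v) w) s ∈ E := hWO _ hs hsO
      have h1 := hEx _ hsE
      have h2 : dist (g v) ((segPath (g v) w) s) ≤ 2 * Φ.δ := by
        have ha1 := dist_meshPoint_le_of_mem_segment hδ hab hseg
        have ha2 := dist_meshPoint_le_of_mem_segment hδ hab hsedge
        linarith [dist_triangle (g v) (meshPoint Φ.δ a) ((segPath (g v) w) s),
          dist_comm (meshPoint Φ.δ a) (g v)]
      have : dist (g v) xb ≤ 2 * (K * ρ) + 2 * Φ.δ := by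
        linarith [dist_triangle (g v) ((segPath (g v) w) s) xb]
      rw [hr₁] at hfarv
      linarith [hδ]
    · push Not at hmeet
      exact hzM (QuadCrossing.Quad.mem_below_of_path hwM (hgQ v) (segPath (g v) w)
        (by rw [range_segPath, segment_symm]; exact fun z hz => (hsub hz).2) hmeet)
  -- Step 11: conclusion
  have hγ₃O : ∀ t ∈ Icc (0 : ℝ) 1, γ₃ t ∈ openEdgeUnion Φ.δ (ω \ S) := fun t ht => by
    obtain ⟨v, hv, hveq, hvfar⟩ := hγ₃pts t ht
    rw [hveq]; exact hfresh v hv hvfar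
  have h0' : dist (γ₃ 0) xb ≤ r₁ := by rw [hγ₃0, hγ₂0, hu₀eq]
  have hmem := mem_annulusOpenCrossing_of_path hδ xb hγ₃c hγ₃O h0' hγ₃R hγ₃1
  rw [mem_annulusOpenCrossingOff_iff]
  have hr₁eq : r₁ + Φ.δ = 2 * (K * ρ) + 4 * Φ.δ := by rw [hr₁]; ring
  have hR₀eq : R₀ - Φ.δ = c₃ / 2 - 4 * (K * ρ) - Φ.δ := by rw [hR₀]
  rw [← hr₁eq, ← hR₀eq]
  exact hmem

end Frame

end SSContinuity

end Literature.Probability.Percolation
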